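import Summits.QuantumFields.YangMills.Theorems.BalabanUVNodesN10AtRecord11B13WalksBlockRealSlice
import Literature.MathematicalPhysics.QuantumFieldTheory.Balaban1983to89.Node00.CarriersB13KernelTower

/-!
# BalabanUVNodes ∕ N10 AT NODE 00's KERNEL TOWER OF RECORD, REAL-SLICE BLOCK EDITION — module 40's junction of [Balaban1988RG2Cluster] Lemmas 1–3 AT
# THE LAYER OF RECORD `lamK.layer` of a kernel-keyed residual layer `lamK : Node00.ResidB13K θ` (node00-def-B13 g4, `Node00/CarriersB13KernelTower`
# p484227): NODE A as ONE operator per term WHOSE BLOCKS ARE THE KERNELS OF RECORD, real-slice entry letters of its σ-free fluctuation operator, the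
# cube decoration and the conditioning operator; the kernels of record re-tagged at the bigger constants record by the PHANTOM constants parameter of
# `B13TermWalkData.TermKernels` (Track A, DAG node N10 [B13]; seat `pub-ymgap-dag-n10-c` g9, module 51B; companion of 51A `…N10B13KernelTowerWalksHolo`)

HONEST FRAMING.  Count-neutral kernel bookkeeping BY NAME over LANDED modules: node00-def-B13 g4's `Node00/CarriersB13KernelTower` (the kernel-keyed
layer `ResidB13K θ`, its (2.14) TERM OF RECORD `T₃`, LAYER OF RECORD `layer`, dictionary theorems `norm_T₃_layer_le ∕ lZ_spec ∕ lD_spec ∕ Gam_eq ∕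
chicP_eq ∕ chiY₀_nonneg ∕ chiY₀_le_one ∕ Vr_eq ∕ rP_nonneg`) and this seat's g5 module 40 `…N10AtRecord11B13WalksBlockRealSlice.
b13LeafOfRecord_of_located_realSlice` (p514129 — module 32's entrywise junction with NODE A's complex-ball letter replaced by REAL-SLICE data; this
seat's `N10-JUNCTION-FORMS.md` v2 recommended it as the junction form to display: it is the shape N06's `B9Thm310Whole.Ops310` letters reach through
modules 33 `B13WalksOfB9Factors` ∕ 39 `B13WalksOfB9FactorsRealSlice`).  THE DEVICE (as in 51A): the constants parameter `c` of `B13TermWalkData.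
TermKernels c d N' ν Nf E` is PHANTOM (no field mentions it), so `({ (lamK.𝒦 Z t) with } : TermKernels cp 4 (lamK.n+1) lamK.ν lamK.Nf lamK.E₃)` IS the
kernel record of record read at module 40's bigger constants record `cp`, every field definitionally `lamK.𝒦 Z t`'s — module 40 keys at def-B13's
tower TODAY with the dictionary PINNED (`𝒦 := {lamK.𝒦 Z t with}`, `uOf := lamK.uOf`, `r := lamK.r`, `lZ := lamK.lZ`, `lD := lamK.lD`, `Γm := lamK.Gam`,
`χY₀ := lamK.chiY₀`, `χcP := lamK.chicP`, `Pl := lamK.Pl`, `rP := lamK.rP`, `Dfam := 𝐃`, `Vr := lamK.Vr`, `emb := lamK.emb`) and the TEN laws `hT₃ hlZ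
hlD hlin hχc hχ0 hχ1 hVr hrP` + `hχm` (the χ_{k,Y₀} of record is a finite product of indicators — measurable; proved in-line, = 51A §0) DISCHARGED.
WHAT §1 DISPLAYS (verbatim from module 40, read at `lamK.layer` ∕ `lamK.𝒦`): the located per-term inputs of LEMMA 1 (pp. 7–9) and LEMMA 2 (pp. 10–11)
about the HIDDEN frame (block geometry, analyticity on (1.34), thresholds ∕ R8 ∕ R9, the in-edges (1.24)∕(1.30) `h124 ∕ h130` BY REFERENCE, `hC`, the
curvature and one-plaquette letters, the floor, gauge invariance by assertion); LEMMA 3's numerics bundle, `R12`, signs; `cp, hκp`, `0 < lamK.r ≤ 1`;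
`α`; `|Pl Z t| = |P|`; the record's bond ∕ cube maps with the consistency of `lamK.emb`; `hχsupp`; measurability of the potentials ∕ small-field region
OF RECORD (`hVm hsmallm` — the frame's `V` and `sp1` are abstract data); the fibre bounds; the reference package `rf` with print's four perturbative
thresholds; and NODE A AS OBJECT DATA: ONE operator `KK Z t σ u` per term on `(lamK.𝒦 Z t).Λ ⊕ C₀` WHOSE BLOCKS ARE THE KERNELS OF RECORD —
`hKA2 : (lamK.𝒦 Z t).A2 σ u = (KK Z t σ u).toBlocks₁₁`, `hKG2 : (lamK.𝒦 Z t).G2 σ u = [0 | KK₁₂]·invSqrt KK` (LOCATED OBJECT IDENTITIES about def-B13's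
data — class A0 of this seat's census v5: they become `rfl` the day def-B13 DEFINES `𝒦 := condKernels (Cᵀ·sDecorate(J′, ½raw ⊕ ½rawᵀ)·C)`; until then
they are displayed, never assumed silently), `hKloc hKX`; the fine-bond index `P Z t`, `locF`; the σ-free fluctuation operator `Δ₀ Z t` with a REAL
STRUCTURE `ℛ` on `lamK.E₃`, an analyticity radius `R_an > 2·rf.R`, entrywise holomorphy + a rate-free bound on the complex `R_an`-ball and
(3.108)-decay AT THE REAL CONFIGURATIONS ONLY ([B9] Thm 3.10's printed regime) + the two-constants matching ([Ransford1995] Thm 4.3.7); the cube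
decoration `J` with its geodesic letter; the (1.11) numerics; the real local averaging operator `C Z t`; the rates and letter match; `hKK` (KK IS
`Cᵀ·sDecorate(…)·C`); ONE positivity `hKacc`; `hKfar hKmult hKdim`; the seven dominations; the exchange thresholds; `ϑ`; the (2.24)–(2.25) smallness;
`hPa`; `hvol`.  So AT THE TOWER OF RECORD N10 reads, with no [B13]-internal regularity hypothesis and no `hΨσ ∕ hΨτ`: located inputs of Lemmas 1–2 about
the hidden frame + in-edges + numerics + ONE conditioned, decorated operator per term with real-slice entry letters of its σ-free fluctuation operator
(NODE A's object content — N06 ∕ def-B13, NOT supplied) + two object identities.  Honesty as in def-B13 §3: at kernel data with a P-bond among the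
Y₀-bonds the H of record vanishes and the zero-tower species re-appears one storey down; nothing here excludes it.  Nothing of Bałaban's is asserted;
N10 is NOT discharged; the K1 item is untouched; no node count moves (typed 28∕28 · discharged 5∕27); Stage-3-keyed (the ₁₂ ∕ ₁₃ ∕ SepCoPH pins apply to
`lamK.layer` BY NAME); one finite four-torus programme at fixed ε per run; nothing continuum ∕ ℝ⁴ ∕ OS ∕ mass-gap ∕ Clay.  0 `sorry`, 0 `def`, standard
axioms.  Filed `--kind proof --supports` K1⁷ «StabilityBAtRecordR13SepCoPH» (stmt-QuantumFields-20542) `--as helper` of route «BalabanUVNodes».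

WHAT THIS FILE PROVES.  §1 `b13LeafOfRecord_layer_of_located_realSlice` (module 40 at the tower: dictionary pinned ∕ discharged, kernels re-tagged
⟹ `B13LeafOfRecord θ lamK.layer`).

References (TYPES and page anchors only): [II] = [Balaban1988RG2Cluster] Lemma 1 p.9, Lemma 2 p.11, Lemma 3 p.20, (1.11) p.5, (2.3) p.12, (2.5)–(2.7)
pp.12–13, (2.14)–(2.26) pp.15–17; [B9] = [Balaban1985BackgroundPropagators] Thm 3.4 p.400, Thm 3.10 (3.107)–(3.108) p.416, Thm 3.12 p.423; [Ransford1995] Thm 4.3.7.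
-/

noncomputable section

namespace Summit.QuantumFields.YangMills.BalabanUVNodes.N10B13KernelTowerWalksRealSlice

open Literature.MathematicalPhysics.QuantumFieldTheory.Balaban1983to89
open Literature.MathematicalPhysics.QuantumFieldTheory.Balaban1983to89.DagBinding
open Literature.MathematicalPhysics.QuantumFieldTheory.Balaban1983to89.Node00
open Literature.MathematicalPhysics.QuantumFieldTheory.Balaban1983to89.B13Lemma3Torus (TwoTorusStep)
open Literature.MathematicalPhysics.QuantumFieldTheory.Balaban1983to89.B13Lemma3TorusSocket (TermDomination Lemma3Numerics)
open Literature.MathematicalPhysics.QuantumFieldTheory.Balaban1983to89.B13Lemma3TorusData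
open Metric
open Literature.MathematicalPhysics.QuantumFieldTheory.Balaban1983to89.B16Absorption (pbox)
open Literature.MathematicalPhysics.QuantumFieldTheory.Balaban1983to89.TreeLengthTorus
open Literature.MathematicalPhysics.QuantumFieldTheory.Balaban1983to89.TreeLengthTorusGeometry
open Literature.MathematicalPhysics.QuantumFieldTheory.Balaban1983to89.TreeLengthTorusTransfer
open Literature.MathematicalPhysics.QuantumFieldTheory.Balaban1983to89.B12TreeDecay (kappa₀ K₀)
open Literature.MathematicalPhysics.QuantumFieldTheory.Balaban1983to89.B13PkScaling (Qop scaled)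
open Literature.MathematicalPhysics.QuantumFieldTheory.Balaban1983to89.B13Bound143 (invTau R12)
open Literature.MathematicalPhysics.QuantumFieldTheory.Balaban1983to89.B13Term214 (term214 SepHolOn core214 F214)
open Literature.MathematicalPhysics.QuantumFieldTheory.Balaban1983to89.B13Lemma3TorusTerms (terms Z0)
open Literature.MathematicalPhysics.QuantumFieldTheory.Balaban1983to89.B5TorusCover (UT)
open Literature.MathematicalPhysics.QuantumFieldTheory.Balaban1983to89.B13TermWalkData (TermKernels)
open Literature.MathematicalPhysics.QuantumFieldTheory.Balaban1983to89.NodeOLettersOfWalksAcross (WalkPackage TermWalks)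
open Literature.MathematicalPhysics.QuantumFieldTheory.Balaban1983to89.NodeOLettersOfWalksPerturbative (RefPackage TermWalksRef)
open Literature.MathematicalPhysics.QuantumFieldTheory.Balaban1983to89.B13Sqrt27Accretive (invSqrt)
open Literature.MathematicalPhysics.QuantumFieldTheory.Balaban1983to89.B9Thm37GlueTorus (tdist1)
open Literature.MathematicalPhysics.QuantumFieldTheory.Balaban1983to89.B13Eq111SDecoupling (sDecorate)
open Literature.MathematicalPhysics.QuantumFieldTheory.Balaban1983to89.B13EntrywiseWalks (RawEntryLetters GeodesicDecoration rawEntryTerm)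
open Literature.MathematicalPhysics.QuantumFieldTheory.Balaban1983to89.B13RealSliceEntryLetters (RealStructure)
open Summit.QuantumFields.YangMills.BalabanUVNodes.N10AtRecord11B13WalksBlockRealSlice (b13LeafOfRecord_of_located_realSlice)
open scoped Matrix

/-! ## §1. THE REAL-SLICE BLOCK JUNCTION AT THE LAYER OF RECORD OF A KERNEL-KEYED LAYER — NODE A as ONE operator per term whose blocks ARE
the kernels of record, real-slice entry letters of its σ-free fluctuation operator, the decoration and the conditioning operator -/

section LayerRealSlice

variable (θ : Stage3Params) (lamK : ResidB13K θ)

-- the junction elaborates ≈ 170 binders and a 172-argument application; twice the default budget (as in module 40 itself)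
set_option maxHeartbeats 400000 in
open Classical in
/-- **THE [B13] LEAF AT NODE 00's KERNEL TOWER OF RECORD FROM REAL-SLICE NODE-A LETTERS OF ONE OPERATOR PER TERM.**  At Stage-3 parameters `θ`
and a kernel-keyed residual layer `lamK : ResidB13K θ`, this is module 40's `b13LeafOfRecord_of_located_realSlice θ lamK.layer` with the dictionary
PINNED to the tower (`𝒦 Z t := ({lamK.𝒦 Z t with} : TermKernels cp …)`, `uOf, r, lZ, lD, Gam, chiY₀, chicP, Pl, rP, 𝐃, Vr, emb`) and its laws
`hT₃ hlZ hlD hlin hχc hχ0 hχ1 hVr hrP` DISCHARGED by node00-def-B13's theorems, `hχm` in-line (a finite product of indicators).  The remaining binders are module 40's, read at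
`lamK.layer` ∕ `lamK.𝒦`: the Lemma 1–2 located inputs about the hidden frame, the numerics, `cp ∕ hκp`, `0 < lamK.r ≤ 1`, the record's objects,
`hVm hsmallm`, the reference package `rf` with print's four perturbative thresholds; NODE A AS OBJECT DATA — ONE operator `KK Z t` per term whose
blocks ARE the kernels of record (`hKA2 hKG2`: located object identities about def-B13's data, `rfl` once `𝒦 := condKernels …` is def-B13's
definition), `hKloc hKX`, the fine-bond index `P Z t ∕ locF`, the σ-free fluctuation operator `Δ₀ Z t` with a real structure `ℛ`, an analyticity
radius `R_an > 2·rf.R`, entrywise holomorphy + a rate-free bound on the complex ball and (3.108)-decay AT THE REAL CONFIGURATIONS ONLY + the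
two-constants matching, the cube decoration `J` with its geodesic letter, the (1.11) numerics, the real local averaging operator `C Z t`, the rates
and letter match, `hKK`, ONE positivity `hKacc`, `hKfar hKmult hKdim`, the dominations —; the exchange thresholds, `ϑ`, the (2.24)–(2.25) smallness,
`hPa`, `hvol`.  CONCLUSION `B13LeafOfRecord θ lamK.layer`.  Count-neutral: hypotheses about the HIDDEN frame and ONE operator per term; nothing of
Bałaban's is asserted.
[cite: Balaban1988RG2Cluster, Lemma 1 p.9, Lemma 2 p.11, Lemma 3 p.20, p.3, (1.11) p.5, (2.5)–(2.7) pp.12–13, p.15, (2.14)–(2.26) pp.15–17; Balaban1985BackgroundPropagators, (3.93) p.410, Thm 3.4 p.400, Thm 3.10 (3.107)–(3.108) p.416, Thm 3.12 p.423; Ransford1995, Thm. 4.3.7] -/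
theorem b13LeafOfRecord_layer_of_located_realSlice
    (hN12 : 12 ≤ (θ.ℓ₆ + 1) * (lamK.layer.n + 1))
    -- (1) LEMMA 1: [I]'s block geometry of the (1.33) index families of the layer
    (dist : TDom 4 ((θ.ℓ₆ + 1) * (lamK.layer.n + 1)) → TPt 4 ((θ.ℓ₆ + 1) * (lamK.layer.n + 1)) → (j : ℕ) →
      TPt 4 ((θ.ℓ₆ + 1) ^ (lamK.layer.k - j) * ((θ.ℓ₆ + 1) * (lamK.layer.n + 1))) → ℝ)
    {K K' : ℝ}
    (hS0Y : ∀ Y, ∀ a ∈ lamK.layer.S0 Y,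
      (pbox (fun i => natLift a i - (5 : ℕ)) (fun i => natLift a i + 1 + (5 : ℕ))).image (proj ((θ.ℓ₆ + 1) * (lamK.layer.n + 1))) ⊆ Y.1)
    (hFsub : ∀ Y a, lamK.layer.F Y a ⊆
      (pbox (fun i => natLift a i - (5 : ℕ)) (fun i => natLift a i + 1 + (5 : ℕ))).image (proj ((θ.ℓ₆ + 1) * (lamK.layer.n + 1))) \
        (pbox (fun i => natLift a i - (4 : ℕ)) (fun i => natLift a i + 1 + (4 : ℕ))).image (proj ((θ.ℓ₆ + 1) * (lamK.layer.n + 1))))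
    (hSq : ∀ Y, ∀ a ∈ lamK.layer.S0 Y, ∀ j, lamK.layer.Sq Y a j ⊆
      (Finset.univ : Finset (TPt 4 ((θ.ℓ₆ + 1) ^ (lamK.layer.k - j) * ((θ.ℓ₆ + 1) * (lamK.layer.n + 1))))).filter
        (fun q => tcoarse ((θ.ℓ₆ + 1) ^ (lamK.layer.k - j)) ((θ.ℓ₆ + 1) * (lamK.layer.n + 1)) q ∈
          (pbox (fun i => natLift a i - (2 : ℕ)) (fun i => natLift a i + 1 + (2 : ℕ))).image (proj ((θ.ℓ₆ + 1) * (lamK.layer.n + 1)))))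
    (hScY : ∀ Y, lamK.layer.Sc Y ⊆ Y.1) (hdist0 : ∀ Y a j q, 0 ≤ lamK.layer.c.δ₀ * dist Y a j q)
    (hdist : ∀ Y a j (n : ℕ) q, q ∉ (pbox (fun i => (((θ.ℓ₆ + 1) ^ (lamK.layer.k - j) : ℕ) : ℤ) * natLift a i - (n + 1 : ℕ))
      (fun i => (((θ.ℓ₆ + 1) ^ (lamK.layer.k - j) : ℕ) : ℤ) * natLift a i + 2 * (((θ.ℓ₆ + 1) ^ (lamK.layer.k - j) : ℕ) : ℤ) - 1 + (n + 1 : ℕ))).image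
        (proj ((θ.ℓ₆ + 1) ^ (lamK.layer.k - j) * ((θ.ℓ₆ + 1) * (lamK.layer.n + 1)))) → lamK.layer.c.δ₀ * lamK.layer.c.M * ((n : ℝ) + 1) ≤ lamK.layer.c.δ₀ * dist Y a j q)
    (hSX : ∀ Y a j q, lamK.layer.SX Y a j q ⊆ (tcubeSys 4 ((θ.ℓ₆ + 1) ^ (lamK.layer.k - j) * ((θ.ℓ₆ + 1) * (lamK.layer.n + 1)))).above q)
    (hSX' : ∀ Y a j q, lamK.layer.SX' Y a j q ⊆ (tcubeSys 4 ((θ.ℓ₆ + 1) ^ (lamK.layer.k - j) * ((θ.ℓ₆ + 1) * (lamK.layer.n + 1)))).above q)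
    (hX0 : ∀ Y, ∀ a ∈ lamK.layer.Sc Y, ∀ j ∈ Finset.range (lamK.layer.k + 1), ∀ q ∈ lamK.layer.Sq' Y a j, ∀ x ∈ lamK.layer.SX' Y a j q,
      x.1.image (tcoarse ((θ.ℓ₆ + 1) ^ (lamK.layer.k - j)) ((θ.ℓ₆ + 1) * (lamK.layer.n + 1))) ⊆ Y.1)
    -- (1) LEMMA 1: per-term analyticity on (1.34)
    (hAnT : ∀ Y, ∀ a ∈ lamK.layer.S0 Y, ∀ X ∈ (lamK.layer.F Y a).powerset, ∀ j ∈ Finset.range (lamK.layer.k + 1), ∀ q ∈ lamK.layer.Sq Y a j,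
      ∀ x ∈ lamK.layer.SX Y a j q, AnalyticOnNhd ℂ (lamK.layer.T Y a X j q x) (lamK.layer.sp1 Y))
    (hAnT' : ∀ Y, ∀ a ∈ lamK.layer.Sc Y, ∀ j ∈ Finset.range (lamK.layer.k + 1), ∀ q ∈ lamK.layer.Sq' Y a j, ∀ x ∈ lamK.layer.SX' Y a j q,
      AnalyticOnNhd ℂ (lamK.layer.T' Y a j q x) (lamK.layer.sp1 Y))
    -- (1) LEMMA 1: thresholds and restrictions on the residual constants
    (hK : 0 ≤ K) (hK' : 0 ≤ K') (hκ : 0 ≤ lamK.layer.c.κ) (hδ1 : lamK.layer.c.δ < 1) (hδκ : 1 ≤ lamK.layer.c.δ * lamK.layer.c.κ)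
    (hκ126 : kappa₀ 64 8 ≤ lamK.layer.c.κ) (hκ126' : kappa₀ 64 8 ≤ lamK.layer.c.δ * lamK.layer.c.κ)
    (hκ₁ : 1 + 2 * Real.log (8 * 12 ^ 3) ≤ lamK.layer.c.κ₁) (hκ₁' : 2 + 16 * Real.log 128 ≤ lamK.layer.c.κ₁)
    (hδ₀M : 10 * Real.exp (-1) ≤ lamK.layer.c.δ₀ * lamK.layer.c.M) (hδ₀M5 : 2 * Real.log 5 ≤ lamK.layer.c.δ₀ * lamK.layer.c.M)
    (hR8 : (1 - lamK.layer.c.δ) * lamK.layer.c.κ ≤ (1 / 4) * (lamK.layer.c.κ₁ - 1))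
    (hR9 : (1 - 2 * lamK.layer.c.δ) * lamK.layer.c.κ ≤ (1 / 16) * lamK.layer.c.κ₁)
    -- (1) LEMMA 1: per-term (1.24), (1.30) by reference to [I] (3.54), (3.17), [15] Prop. 4, [13] (3.108); the constants with headroom (1 − θ₁)
    (h124 : ∀ Y φ, φ ∈ lamK.layer.sp1 Y → ∀ a ∈ lamK.layer.S0 Y, ∀ X ∈ (lamK.layer.F Y a).powerset, ∀ j ∈ Finset.range (lamK.layer.k + 1), ∀ q ∈ lamK.layer.Sq Y a j,
      ∀ x ∈ lamK.layer.SX Y a j q,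
        ‖lamK.layer.T Y a X j q x φ‖ ≤ K * (((θ.ℓ₆ + 1 : ℕ) : ℝ) ^ j * (((θ.ℓ₆ + 1 : ℕ) : ℝ) ^ lamK.layer.k)⁻¹) ^ 5 *
          Real.exp (-(lamK.layer.c.κ₁ - 1) *
            (((Y.1 \ (pbox (fun i => natLift a i - (5 : ℕ)) (fun i => natLift a i + 1 + (5 : ℕ))).image
              (proj ((θ.ℓ₆ + 1) * (lamK.layer.n + 1)))).card : ℝ) + X.card)) *
          Real.exp (-(lamK.layer.c.κ * torusTreeLen x.1)))
    (h130 : ∀ Y φ, φ ∈ lamK.layer.sp1 Y → ∀ a ∈ lamK.layer.Sc Y, ∀ j ∈ Finset.range (lamK.layer.k + 1), ∀ q ∈ lamK.layer.Sq' Y a j,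
      ∀ x ∈ lamK.layer.SX' Y a j q,
        ‖lamK.layer.T' Y a j q x φ‖ ≤ K' * Real.exp (-(1 / 2) * (lamK.layer.c.δ₀ * lamK.layer.c.M) * (((θ.ℓ₆ + 1 : ℕ) : ℝ) ^ j * (((θ.ℓ₆ + 1 : ℕ) : ℝ) ^ lamK.layer.k)⁻¹)⁻¹
            - (1 / 2) * lamK.layer.c.δ₀ * dist Y a j q) *
          Real.exp (-(lamK.layer.c.κ₁ - 1) * ((Y.1 \ x.1.image (tcoarse ((θ.ℓ₆ + 1) ^ (lamK.layer.k - j)) ((θ.ℓ₆ + 1) * (lamK.layer.n + 1)))).card : ℝ)) *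
          Real.exp (-(lamK.layer.c.κ * torusTreeLen x.1)))
    {θ₁ : ℝ} (hθ₁0 : 0 ≤ θ₁) (hθ₁1 : θ₁ < 1)
    (hC : K * K₀ 64 8 * (2 * (6 * ((θ.ℓ₆ + 1 : ℕ) : ℝ)) ^ 4) * Real.exp 1 * Real.exp ((1 / 8) * lamK.layer.c.κ₁ * (12 ^ 4 - 1)) +
        2 * (64 * K') * K₀ 64 8 * 1344 ≤
      (1 - θ₁) * (lamK.layer.c.E₀ * lamK.layer.c.ε₁ * lamK.layer.c.C₁ * lamK.layer.c.M ^ lamK.layer.c.q * Real.exp (lamK.layer.c.C₂ * lamK.layer.c.κ₁)))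
    -- (2) LEMMA 2 (pp. 10–11): the curvature terms; the located per-term data of `B13Lemma2Torus.lemma2Printed_twoTorus'` for the layer's plaquette data
    (hGlAn : ∀ Y, AnalyticOnNhd ℂ (lamK.layer.Gl Y) (lamK.layer.sp1 Y))
    (hGl : ∀ Y φ, φ ∈ lamK.layer.sp1 Y → ‖lamK.layer.Gl Y φ‖ ≤ θ₁ * (lamK.layer.c.E₀ * lamK.layer.c.ε₁ * lamK.layer.c.C₁ * lamK.layer.c.M ^ lamK.layer.c.q * Real.exp (lamK.layer.c.C₂ * lamK.layer.c.κ₁)) *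
      Real.exp (-((1 - 2 * lamK.layer.c.δ) * lamK.layer.c.κ * (tsys 4 ((θ.ℓ₆ + 1) * (lamK.layer.n + 1))).dj Y)))
    (he : ∀ Y b, ‖lamK.layer.e Y b‖ ≤ 1) (hg : lamK.layer.g ≠ 0) {R K₂ : ℝ} {m₂ : ℕ} (hK₂ : 0 ≤ K₂) (hR : 0 < R) (hε3 : 3 * lamK.layer.c.ε₁ ≤ R)
    (hW : ∀ Y, ∀ i ∈ lamK.layer.s Y, ∀ φ ∈ lamK.layer.sp1 Y, AnalyticOnNhd ℂ (lamK.layer.Wf Y i φ) (ball 0 R))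
    (hKW : ∀ Y, ∀ i ∈ lamK.layer.s Y, ∀ φ ∈ lamK.layer.sp1 Y, ∀ z ∈ ball (0 : lamK.layer.E) R,
      ‖lamK.layer.Wf Y i φ z‖ ≤ K₂ * Real.exp (-(lamK.layer.c.κ₁ - 1) * ((Y.1.card : ℝ) - 1)) * ‖z‖ ^ 3)
    (hcard : ∀ Y, (lamK.layer.s Y).card ≤ m₂ * Y.1.card) (hsp : ∀ Y φ, φ ∈ lamK.layer.sp1 Y → ‖lamK.layer.g‖ * ‖lamK.layer.rd Y φ‖ < lamK.layer.c.ε₁)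
    (hfloor : 27 * m₂ * K₂ * Real.exp (lamK.layer.c.κ₁ - 1) ≤ lamK.layer.c.C₃ * lamK.layer.c.M ^ 4 * Real.exp (lamK.layer.c.C₂ * lamK.layer.c.κ₁))
    (hAnP : ∀ Y, ∀ i ∈ lamK.layer.s Y, AnalyticOnNhd ℂ (fun φ => scaled lamK.layer.g (lamK.layer.Wf Y i φ) (lamK.layer.rd Y φ)) (lamK.layer.sp1 Y))
    (hG : ∀ Y, lamK.layer.GaugeInv (lamK.layer.V Y) ∧ lamK.layer.GaugeInv ((WtOfRecord θ lamK.layer).toStepData.quadForm Y) ∧ lamK.layer.GaugeInv (lamK.layer.Vpp Y))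
    -- (3) LEMMA 3 (pp. 14–20): the signs of (2.18)–(2.20), R12, |τ(Y)| ≥ 2, and the numerics bundle at ℓ = ½L
    (hL8 : 8 ≤ θ.ℓ₆ + 1) {a a₂ a₂' a₅ Aabs : ℝ}
    (hN : Lemma3Numerics (c13OfRecord θ lamK.layer) (lamK.layer.m₃ + 1) (((θ.ℓ₆ + 1 : ℕ) : ℝ) / 2) a a₂ a₂' a₅ Aabs)
    (h12 : R12 (c13OfRecord θ lamK.layer)) (hE : 0 < lamK.layer.c.E₀) (hε : 0 < lamK.layer.c.ε₁) (hC₁ : 0 < lamK.layer.c.C₁) (hα : 0 < lamK.layer.c.α₄)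
    (hM : 1 ≤ lamK.layer.c.M)
    (hτ2 : lamK.layer.c.E₀ * lamK.layer.c.ε₁ * lamK.layer.c.C₁ * lamK.layer.c.α₄⁻¹ * lamK.layer.c.M ^ lamK.layer.c.q * Real.exp (lamK.layer.c.C₂ * lamK.layer.c.κ₁) ≤ 1 / 2)
    -- (3) the Cauchy radius and the parameter domains (p. 15)
    -- the bigger σ-polydisc (a second constants record `cp` lending its `κ₁`; NODE A's kernels are tagged at `cp`) and a
    -- Cauchy radius `r ≤ 1`; the τ-regions are the open discs of radii `2|τ(Y)|` (chosen inside)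
    (cp : B13.Consts) (hκp : lamK.layer.c.κ₁ < cp.κ₁) (hr : 0 < lamK.r) (hr1 : lamK.r ≤ 1)
    -- (3) THE DICTIONARY IS def-B13's KERNEL TOWER (`lamK.𝒦 ∕ uOf ∕ r ∕ lZ ∕ lD ∕ Gam ∕ chiY₀ ∕ chicP ∕ Pl ∕ rP ∕ Vr ∕ emb`, `Dfam := 𝐃`; `Γ(σ) = G(σ)·` is
    --     `ResidB13K.Gam_eq`): only the configuration size `α` and the `|P|` row-bond count stay located
    {α : ℝ} (hαnn : 0 ≤ α) (huα : ∀ Z, ∀ t ∈ terms (θ.ℓ₆ + 1) (lamK.layer.m₃ + 1) Z, ∀ φ ∈ lamK.layer.sp2 Z, ‖lamK.uOf Z t φ‖ ≤ α)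
    (hPcard : ∀ Z, ∀ t ∈ terms (θ.ℓ₆ + 1) (lamK.layer.m₃ + 1) Z, (lamK.Pl Z t).card = t.2.card)
    -- (3) the record's objects behind the terms: bonds, cubes, the real field inside the configurations
    (ιb : (Z : TDom 4 (lamK.layer.n + 1)) → (t : Finset (TDom 4 ((θ.ℓ₆ + 1) * (lamK.layer.n + 1))) × Finset (TBond 4 (lamK.layer.m₃ + 1) ((θ.ℓ₆ + 1) * (lamK.layer.n + 1)))) → (lamK.𝒦 Z t).Λ → lamK.layer.Bond)
    (hι : ∀ Z t, Function.Injective (ιb Z t)) (cube : lamK.layer.Bond → TPt 4 ((θ.ℓ₆ + 1) * (lamK.layer.n + 1)))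
    (hQsupp : ∀ (Y : TDom 4 ((θ.ℓ₆ + 1) * (lamK.layer.n + 1))) φ b b', lamK.layer.Q Y φ b b' ≠ 0 → cube b ∈ Y.1 ∧ cube b' ∈ Y.1) {m' : ℕ}
    (hfibc : ∀ Z t (x : TPt 4 ((θ.ℓ₆ + 1) * (lamK.layer.n + 1))), (Finset.univ.filter fun j => cube (ιb Z t j) = x).card ≤ m')
    (hBv : ∀ Z t φ B b, lamK.layer.Bv (lamK.emb Z t φ B) (ιb Z t b) = (B b : ℂ))
    (hBv0 : ∀ Z t φ B b', b' ∉ Set.range (ιb Z t) → lamK.layer.Bv (lamK.emb Z t φ B) b' = 0)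
    (hχsupp : ∀ Z, ∀ t ∈ terms (θ.ℓ₆ + 1) (lamK.layer.m₃ + 1) Z, ∀ φ ∈ lamK.layer.sp2 Z, ∀ B, lamK.chiY₀ Z t B ≠ 0 → ∀ Y ∈ t.1,
      lamK.emb Z t φ B ∈ lamK.layer.sp1 Y)
    -- (3) measurability of the layer's potentials and small-field region in the bond variables (`χ_{k,Y₀}` of record IS measurable, §0)
    (hVm : ∀ Z t φ Y, Measurable (lamK.Vr Z t φ Y))
    (hsmallm : ∀ Z t φ, MeasurableSet {B : (lamK.𝒦 Z t).Λ → ℝ | ∀ Y ∈ t.1, lamK.emb Z t φ B ∈ lamK.layer.sp1 Y}) {γ₂ : ℝ} (hγ₂ : 0 ≤ γ₂)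
    -- (3) uniform fibre bounds of the bond locations
    {m : ℕ} (hfibΛ : ∀ Z t (x : UT lamK.Nf), (Finset.univ.filter fun i => (lamK.𝒦 Z t).locΛ i = x).card ≤ m)
    (hfibN : ∀ Z t (x : UT lamK.Nf), (Finset.univ.filter fun j => (lamK.𝒦 Z t).locN j = x).card ≤ m)
    -- (3) THE REFERENCE RUNG ON THE TERMS OF THE STEP OF RECORD (the displayed hypothesis, n10-b's reference currency):
    --     ONE admissible reference package `rf`, an accretivity radius `0 < R₁ < R`, print's two perturbative sources (p. 15:
    --     «O(1)e^{−⅓δ₀M} + O(α₀ + α₁)» against the reference positivity) as FOUR DIVISION-FREE THRESHOLDS, positive input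
    --     rates and `η ≤ etaMax` of the W-walks package `rf.toWalkPackage R₁` (standard rate book: `κ_C = κ_C⋆`, `ρ′ = μ∕4`),
    --     `TermWalksRef` for the kernels of every term, round letters, and PRINT's TWO EXCHANGE THRESHOLDS for a `θ₀ > 0`
    (rf : RefPackage) (hrf : rf.Admissible) {R₁ : ℝ} (hR₁ : 0 < R₁) (hR₁R : R₁ < rf.R)
    (hPσ : 8 * rf.KbarP * rf.cV₀ * Real.exp (-(rf.εP * rf.Rσ)) ≤ rf.m₀) (hP₁ : 8 * rf.KbarP * rf.cV₀ * R₁ ≤ rf.m₀ * rf.R)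
    (hAσ : 8 * rf.KbarA * rf.cV * Real.exp (-(rf.εA * rf.Rσ)) ≤ rf.mA₀) (hA₁ : 8 * rf.KbarA * rf.cV * R₁ ≤ rf.mA₀ * rf.R)
    (hp : (rf.toWalkPackage R₁).PositiveRates) (hη : rf.η ≤ (rf.toWalkPackage R₁).etaMax) (hαR : α < R₁)
    -- (3) NODE A's KERNEL DATA READ OFF ONE OPERATOR PER TERM — print's `C*Δ_k(σ(Z),𝐔,𝐉)C` after the conditioning (2.5)–(2.6): block
    --     reading; ONE expansion at `rf`'s full-precision letters whose terms are `s`-MONOMIALS times σ-free operators ([II] p. 3) and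
    --     carry a WALK REVERSAL ([13] (3.107)); ONE positivity; geometry; dominations in `rf`
    (KK : (Z : TDom 4 (lamK.layer.n + 1)) → (t : Finset (TDom 4 ((θ.ℓ₆ + 1) * (lamK.layer.n + 1))) × Finset (TBond 4 (lamK.layer.m₃ + 1) ((θ.ℓ₆ + 1) * (lamK.layer.n + 1)))) →
      (TPt 4 (lamK.layer.n + 1) → ℂ) → lamK.E₃ → Matrix ((lamK.𝒦 Z t).Λ ⊕ (lamK.𝒦 Z t).C₀) ((lamK.𝒦 Z t).Λ ⊕ (lamK.𝒦 Z t).C₀) ℂ)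
    (hKA2 : ∀ Z t σ u, (lamK.𝒦 Z t).A2 σ u = (KK Z t σ u).toBlocks₁₁)
    (hKG2 : ∀ Z t σ u, (lamK.𝒦 Z t).G2 σ u
      = Matrix.fromCols (0 : Matrix (lamK.𝒦 Z t).Λ (lamK.𝒦 Z t).Λ ℂ) (KK Z t σ u).toBlocks₁₂ * invSqrt (KK Z t σ u))
    (hKloc : ∀ Z t i, (lamK.𝒦 Z t).locΛ i = (lamK.𝒦 Z t).locN (Sum.inl i))
    (hKX : ∀ Z, ∀ t ∈ terms (θ.ℓ₆ + 1) (lamK.layer.m₃ + 1) Z, (lamK.𝒦 Z t).X.Nonempty)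
    -- (3″) NODE A's OBJECT DATA AS ENTRYWISE LETTERS (census v5 class A2′ in its ENTRYWISE form ∧ A2″ as ONE geometric letter ∧ A2‴; replaces
    --      module 21's `hKexp`; ym-nodeO-ideate P2 g30's reduction, tree module `B13EntrywiseWalks`): per term, the fine-bond index `P Z t` located by
    --      `locF`; TWO ENTRYWISE LETTERS of the σ-free fluctuation operator `Δ₀ Z t` on the complex `rf.R`-ball — (3.108)-type decay
    --      `‖Δ₀(u)_{ij}‖ ≤ B·e^{−ρ·d₁(i,j)}` and entrywise holomorphy (`RawEntryLetters`) —, a fibre bound; the cube decoration `J` on PAIRS of fine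
    --      bonds with the GEODESIC letter (`|J(i,j)| ≤ c₀ + d₁(i,j)∕M₁`, a decorated pair joined by a `d₁`-geodesic through `(lamK.𝒦 Z t).X`); the (1.11)
    --      numerics `0 < η ≤ ε < ρ`, `2κ₁ ≤ ηM₁`; the REAL constant local averaging operator `C Z t` of (2.5) (`|C| ≤ 1`, range `rC`); a junction
    --      rate `μΔ`; the letter match with `rf`; and `KK Z t` IS `Cᵀ·sDecorate(J′, ½raw ⊕ ½rawᵀ)·C` (`hKK`)
    (P : TDom 4 (lamK.layer.n + 1) → Finset (TDom 4 ((θ.ℓ₆ + 1) * (lamK.layer.n + 1))) × Finset (TBond 4 (lamK.layer.m₃ + 1) ((θ.ℓ₆ + 1) * (lamK.layer.n + 1))) → Type)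
    [∀ Z t, Fintype (P Z t)] [∀ Z t, DecidableEq (P Z t)]
    (locF : (Z : TDom 4 (lamK.layer.n + 1)) → (t : Finset (TDom 4 ((θ.ℓ₆ + 1) * (lamK.layer.n + 1))) × Finset (TBond 4 (lamK.layer.m₃ + 1) ((θ.ℓ₆ + 1) * (lamK.layer.n + 1)))) →
      P Z t → UT lamK.Nf)
    (Δ₀ : (Z : TDom 4 (lamK.layer.n + 1)) → (t : Finset (TDom 4 ((θ.ℓ₆ + 1) * (lamK.layer.n + 1))) × Finset (TBond 4 (lamK.layer.m₃ + 1) ((θ.ℓ₆ + 1) * (lamK.layer.n + 1)))) →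
      lamK.E₃ → Matrix (P Z t) (P Z t) ℂ)
    {ρΔ BΔ εΔ κΔ ηΔ μΔ M₁ rC : ℝ} {mF c₀ : ℕ}
    -- REPLACES module 32's `hEL` (the entrywise letters of `Δ₀ Z t` ON THE COMPLEX `rf.R`-BALL): a real structure on the configuration space `lamK.E₃`
    -- (which configurations are «real», e.g. the Hermitian locus of the chart — a datum); per term, on the complex ball of an ANALYTICITY radius
    -- `R_an > 2·rf.R` ([II] p.15 «α′₀, α′₁ much bigger»): entrywise holomorphy of `Δ₀ Z t` ([B9] Thm 3.4 first sentence) and a RATE-FREE bound `M_b`;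
    -- (3.108)-type decay with letters `(ρr, Br)` AT THE REAL CONFIGURATIONS ONLY ([B9] Thm 3.10 — print's proved regime); and the two-constants
    -- matching of the junction's rate∕constant `(ρΔ, BΔ)` with `λ = lam (rf.R ∕ (R_an − rf.R)) ≤ (4∕π)·rf.R∕(R_an − rf.R)`
    (ℛ : RealStructure lamK.E₃) {Ran Mb ρr Br : ℝ} (h2R : 2 * rf.R < Ran)
    (hholoΔ : ∀ Z, ∀ t ∈ terms (θ.ℓ₆ + 1) (lamK.layer.m₃ + 1) Z, ∀ i j, DifferentiableOn ℂ (fun u => Δ₀ Z t u i j) (ball (0 : lamK.E₃) Ran))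
    (hMbΔ : ∀ Z, ∀ t ∈ terms (θ.ℓ₆ + 1) (lamK.layer.m₃ + 1) Z, ∀ u ∈ ball (0 : lamK.E₃) Ran, ∀ i j, ‖Δ₀ Z t u i j‖ ≤ Mb)
    (hrealΔ : ∀ Z, ∀ t ∈ terms (θ.ℓ₆ + 1) (lamK.layer.m₃ + 1) Z, ∀ v ∈ ℛ.Ereal, ‖v‖ < Ran →
      ∀ i j, ‖Δ₀ Z t v i j‖ ≤ Br * Real.exp (-(ρr * tdist1 lamK.Nf (locF Z t i) (locF Z t j))))
    (hBr0 : 0 ≤ Br) (hBrM : Br ≤ Mb) (hρr : 0 ≤ ρr) (hρΔ : ρΔ ≤ (1 - B13RealSliceEntryLetters.lam (rf.R / (Ran - rf.R))) * ρr)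
    (hBΔ : Br ^ (1 - B13RealSliceEntryLetters.lam (rf.R / (Ran - rf.R))) * Mb ^ B13RealSliceEntryLetters.lam (rf.R / (Ran - rf.R)) ≤ BΔ)
    (hfibF : ∀ Z t (y : UT lamK.Nf), (Finset.univ.filter fun k => locF Z t k = y).card ≤ mF)
    (J : (Z : TDom 4 (lamK.layer.n + 1)) → (t : Finset (TDom 4 ((θ.ℓ₆ + 1) * (lamK.layer.n + 1))) × Finset (TBond 4 (lamK.layer.m₃ + 1) ((θ.ℓ₆ + 1) * (lamK.layer.n + 1)))) →
      P Z t × P Z t → Finset (TPt 4 (lamK.layer.n + 1)))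
    (hGJ : ∀ Z, ∀ t ∈ terms (θ.ℓ₆ + 1) (lamK.layer.m₃ + 1) Z, GeodesicDecoration (J Z t) (locF Z t) (lamK.𝒦 Z t).X c₀ M₁) (hηΔ : 0 < ηΔ) (hηε : ηΔ ≤ εΔ)
    (hρε : εΔ < ρΔ) (hP2 : 2 * cp.κ₁ ≤ ηΔ * M₁)
    (C : (Z : TDom 4 (lamK.layer.n + 1)) → (t : Finset (TDom 4 ((θ.ℓ₆ + 1) * (lamK.layer.n + 1))) × Finset (TBond 4 (lamK.layer.m₃ + 1) ((θ.ℓ₆ + 1) * (lamK.layer.n + 1)))) →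
      Matrix (P Z t) ((lamK.𝒦 Z t).Λ ⊕ (lamK.𝒦 Z t).C₀) ℝ)
    (hCle : ∀ Z t k i, |C Z t k i| ≤ 1) (hCsupp : ∀ Z t k i, C Z t k i ≠ 0 → tdist1 lamK.Nf (locF Z t k) ((lamK.𝒦 Z t).locN i) ≤ rC) (hμΔ : 0 < μΔ)
    (hμε : 2 * μΔ ≤ εΔ - ηΔ) (hμκ : 2 * μΔ ≤ κΔ) (hκεΔ : κΔ ≤ ρΔ - εΔ) (hεP : rf.εP ≤ εΔ - ηΔ - μΔ - μΔ) (hkapP : rf.kapP ≤ κΔ - μΔ - μΔ)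
    (hKP : (mF * B6.c0 1 μΔ ^ lamK.ν) * ((mF * B6.c0 1 μΔ ^ lamK.ν) * Real.exp ((ρΔ - ηΔ) * rC) *
      (Real.exp (cp.κ₁ * (2 * c₀ : ℕ)) * (BΔ * (mF * mF + 1))) * B6.c0 1 μΔ ^ lamK.ν) *
      Real.exp ((ρΔ - ηΔ - μΔ) * rC) * B6.c0 1 μΔ ^ lamK.ν ≤ rf.KbarP)
    (hKK : ∀ Z t σ u, KK Z t σ u =
      ((C Z t).map (algebraMap ℝ ℂ))ᵀ *
        sDecorate (fun ω : (P Z t × P Z t) ⊕ (P Z t × P Z t) => J Z t (Sum.elim id id ω))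
          (fun ω u => Sum.elim (fun ω => (1 / 2 : ℂ) • rawEntryTerm (Δ₀ Z t) ω u)
            (fun ω => (1 / 2 : ℂ) • (rawEntryTerm (Δ₀ Z t) ω u)ᵀ) ω) σ u *
        (C Z t).map (algebraMap ℝ ℂ))
    (hKacc : ∀ Z, ∀ t ∈ terms (θ.ℓ₆ + 1) (lamK.layer.m₃ + 1) Z, ∀ v : (lamK.𝒦 Z t).Λ ⊕ (lamK.𝒦 Z t).C₀ → ℂ,
      rf.m₀ * ∑ i, ‖v i‖ ^ 2 ≤ (∑ i, star (v i) * (KK Z t 0 0 *ᵥ v) i).re)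
    (hKfar : ∀ Z, ∀ t ∈ terms (θ.ℓ₆ + 1) (lamK.layer.m₃ + 1) Z, ∀ k, ∀ z ∈ (lamK.𝒦 Z t).X, rf.Rσ ≤ tdist1 lamK.Nf ((lamK.𝒦 Z t).locN k) z)
    (hKmult : ∀ Z, ∀ t ∈ terms (θ.ℓ₆ + 1) (lamK.layer.m₃ + 1) Z, ∀ x : UT lamK.Nf,
      (Finset.univ.filter fun k => (lamK.𝒦 Z t).locN k = x).card ≤ rf.nB)
    (hKdim : lamK.ν ≤ rf.dm) (hεL : rf.εL ≤ rf.εP) (hκL : rf.kapL ≤ rf.kapP) (hKL : rf.KbarP ≤ rf.KbarL) (hεA : rf.εA ≤ rf.εP) (hκA : rf.kapA ≤ rf.kapP)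
    (hKA : rf.KbarP ≤ rf.KbarA) (hmA : rf.mA₀ ≤ rf.m₀) {KG KCs θ₀ : ℝ} (hKG : (rf.toWalkPackage R₁).Kbar ≤ KG) (hKCs : 8 / rf.mA₀ ≤ KCs) (hθ₀ : 0 < θ₀)
    (hαsmall : α ≤ θ₀ * R₁ / (4 * (rf.toWalkPackage R₁).Kbar + 4))
    (hRσlarge : Real.log ((4 * (rf.toWalkPackage R₁).Kbar + 4) / θ₀)
      / ((rf.toWalkPackage R₁).mu / 4 - (rf.toWalkPackage R₁).kapCStar) ≤ rf.Rσ)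
    -- (3) rates below the package's κ_C⋆, and NODE A's letter ϑ (θ_Γ = θ_E = θ₀, K_Γ = K_G, K₀′ = K_Cs, θ_C derived)
    {kap kap' kap'' kap₂ ϑ : ℝ} (hkap'' : 0 < kap'') (hk1 : kap'' < kap') (hk2 : kap' < kap) (hk3 : kap < kap₂)
    (hk4 : kap₂ < (rf.toWalkPackage R₁).kapCStar) (hθ₀le : θ₀ ≤ ϑ)
    (hθR1le : (m * (1 + 2 / (kap - kap')) ^ lamK.ν) * (m * (1 + 2 / (kap' - kap'')) ^ lamK.ν)
      * (θ₀ * KCs * KG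
        + KG * (KCs * θ₀ * (m * (1 + 2 / ((rf.toWalkPackage R₁).kapCStar - kap₂)) ^ lamK.ν) * KCs * (m * (1 + 2 / (kap₂ - kap)) ^ lamK.ν)) * KG
        + KG * KCs * θ₀) ≤ ϑ)
    (hsmallKθ : KCs * (m * (1 + 2 / kap) ^ lamK.ν) * (ϑ * (m * (1 + 2 / kap'') ^ lamK.ν)) < 1)
    -- (3) the (2.24)–(2.25) smallness with `a₂₀ = 2·m′·α₄·M⁻⁴(1 + 32/(κ₁−1))⁴`; the eigenvalue bound of C is the NUMBER
    --     `2∕m_{A,0} ≤ cE`; the form bound of Γ₀ is the NUMBER `g = B_Γ²c_V·m c₀(1,η)^ν∕(m_{A,0}∕2)`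
    {cE : ℝ} (hc0 : 0 ≤ cE) (hcE : 2 / rf.mA₀ ≤ cE)
    (hαc : (2 * (ϑ * (m * (1 + 2 / kap'') ^ lamK.ν)) +
      (γ₂ + 2 * (m' * lamK.layer.c.α₄ * (lamK.layer.c.M ^ 4)⁻¹ * (1 + 32 / (lamK.layer.c.κ₁ - 1)) ^ 4))) * cE ≤ 1 / 2)
    (hsmall : (2 * (ϑ * (m * (1 + 2 / kap'') ^ lamK.ν)) +
      (γ₂ + 2 * (m' * lamK.layer.c.α₄ * (lamK.layer.c.M ^ 4)⁻¹ * (1 + 32 / (lamK.layer.c.κ₁ - 1)) ^ 4))) * (1 + 2 * cE * (((rf.toWalkPackage R₁).BΓ * rf.cV) * ((rf.toWalkPackage R₁).BΓ * (m * B6.c0 1 rf.η ^ lamK.ν)) / (rf.mA₀ / 2))) ≤ 1 / 2)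
    -- (3) constant matching, p. 17: `a ≤ γ₂ r_P²` and the volume factor with `w = 2·K₀(64,8)·α₄·#(⋃𝐃)`
    (hPa : a ≤ γ₂ * lamK.rP ^ 2)
    (hvol : ∀ Z, ∀ t ∈ terms (θ.ℓ₆ + 1) (lamK.layer.m₃ + 1) Z,
      2 * (KCs * (m * (1 + 2 / kap) ^ lamK.ν) * (ϑ * (m * (1 + 2 / kap'') ^ lamK.ν))
              * (1 + (1 - KCs * (m * (1 + 2 / kap) ^ lamK.ν) * (ϑ * (m * (1 + 2 / kap'') ^ lamK.ν)))⁻¹) / 2)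
          * (Fintype.card (lamK.𝒦 Z t).Λ : ℝ)
        + 2 * (K₀ 64 8 * lamK.layer.c.α₄ * ((((t.1).image Subtype.val).biUnion id).card : ℝ))
        + (2 * (ϑ * (m * (1 + 2 / kap'') ^ lamK.ν)) +
            (γ₂ + 2 * (m' * lamK.layer.c.α₄ * (lamK.layer.c.M ^ 4)⁻¹ * (1 + 32 / (lamK.layer.c.κ₁ - 1)) ^ 4))) * cE * (Fintype.card (lamK.𝒦 Z t).Λ : ℝ)
        + (2 * (ϑ * (m * (1 + 2 / kap'') ^ lamK.ν)) +
            (γ₂ + 2 * (m' * lamK.layer.c.α₄ * (lamK.layer.c.M ^ 4)⁻¹ * (1 + 32 / (lamK.layer.c.κ₁ - 1)) ^ 4))) * (1 + 2 * cE * (((rf.toWalkPackage R₁).BΓ * rf.cV) * ((rf.toWalkPackage R₁).BΓ * (m * B6.c0 1 rf.η ^ lamK.ν)) / (rf.mA₀ / 2)))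
            * (Fintype.card ((lamK.𝒦 Z t).Λ ⊕ (lamK.𝒦 Z t).C₀) : ℝ)
        ≤ a₅ * ((Z.1).card : ℝ)) :
    B13LeafOfRecord θ lamK.layer :=
  b13LeafOfRecord_of_located_realSlice θ lamK.layer
    hN12 dist hS0Y hFsub hSq hScY hdist0 hdist hSX hSX' hX0 hAnT hAnT' hK hK' hκ hδ1 hδκ hκ126 hκ126' hκ₁ hκ₁' hδ₀M hδ₀M5 hR8 hR9 h124 h130 hθ₁0
    hθ₁1 hC hGlAn hGl he hg hK₂ hR hε3 hW hKW hcard hsp hfloor hAnP hG hL8 hN h12 hE hε hC₁ hα hM hτ2 cp hκp hr hr1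
    (fun Z t => ({ (lamK.𝒦 Z t) with } : TermKernels cp 4 (lamK.layer.n + 1) lamK.ν lamK.Nf lamK.E₃)) lamK.uOf hαnn huα lamK.lZ
    (fun Z t _ => lamK.lZ_spec Z t) (fun _ t => lamK.lD t) (fun _ t _ => lamK.lD_spec t) lamK.Gam lamK.chiY₀ lamK.chicP lamK.chiY₀_nonneg
    lamK.chiY₀_le_one lamK.Pl hPcard (lamK.rP_nonneg hε.le) (fun Z t B => lamK.chicP_eq Z t B) (fun _ t => t.1) lamK.Vr
    (fun Z t _ φ _ => lamK.norm_T₃_layer_le Z t φ) ιb hι cube hQsupp hfibc lamK.emb hBv hBv0 (fun Z t _ φ _ Y _ B _ => lamK.Vr_eq Z t φ Y B) hχsupp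
    (fun Z t => by
      unfold ResidB13K.chiY₀
      exact Finset.measurable_prod _ fun b _ =>
        Measurable.ite (measurableSet_lt (measurable_pi_apply b).abs measurable_const) measurable_const measurable_const)
    hVm hsmallm (fun Z t _ φ _ σ _ X => lamK.Gam_eq Z t φ σ X) hγ₂ hfibΛ hfibN rf hrf hR₁ hR₁R hPσ hP₁ hAσ hA₁ hp hη hαR KK
    hKA2 hKG2 hKloc hKX P locF Δ₀ ℛ h2R hholoΔ hMbΔ hrealΔ hBr0 hBrM hρr hρΔ hBΔ hfibF J hGJ hηΔ hηε hρε hP2 C hCle hCsupp hμΔ hμε hμκ hκεΔ hεP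
    hkapP hKP hKK hKacc hKfar hKmult hKdim hεL hκL hKL hεA hκA hKA hmA hKG hKCs hθ₀ hαsmall hRσlarge hkap'' hk1 hk2 hk3 hk4 hθ₀le hθR1le hsmallKθ
    hc0 hcE hαc hsmall hPa hvol

end LayerRealSlice

end Summit.QuantumFields.YangMills.BalabanUVNodes.N10B13KernelTowerWalksRealSlice

end
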